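import Summits.CriticalPhenomena.PercolationContinuityZ3.Theorems.PercNearOneGluingNoHeavyLowerTailCILPortDomination
import Summits.CriticalPhenomena.PercolationContinuityZ3.Theorems.PercNearOneGluingNoHeavyLowerTailHullPortDecomposition
import Summits.CriticalPhenomena.PercolationContinuityZ3.Theorems.PercNearOneGluingNoHeavyLowerTailHullPortComparison
import Summits.CriticalPhenomena.PercolationContinuityZ3.Theorems.PercNearOneGluingNoHeavyLowerTailHullPortDepthTwo
import HarnessLib

/-!
# `NoHeavyLowerTail` (stmt-CriticalPhenomena-4575) — the hull-port conjecture for hulls of size ≤ 2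

Support file (prover `prim-hp-1`, hull-port / coupling line; `--supports stmt-CriticalPhenomena-4575`).  No definitions,
no named facts, no sorries.

Notation: `μ = prodBernoulli w` on `Fin n`, relays `A`, level `j`, `π(v) = {x ∈ A : v ↔ x}`, `N = |π(o)|`; the HULL of an
observer `o ∉ A` is its component in the positive-weight graph on the non-relay vertices, its PORTS are the relays adjacent to
the hull; `H`-lightness of a relay `q` is `μ{|π'(q)| ≤ j}` with `π'` computed WITHOUT the pairs at `o` (graph `G − o`).

The lead's hull-port conjecture (crux evidence LEAD-GEN1.md (Ψ)/(V1), re-censused in HULLPORT-COUPLING.md: 0 violations in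
32 400 exact instances) says: every relay `b` at least as `H`-light as every port is a CIL witness, `μ{1 ≤ N ≤ j} ≤ μ{|π(b)| ≤ j}`.
It is proved in the tree for hulls `{o}` (`Theorems.cil_relayNeighbours`, prover `prim-gen-induct`).  This file proves it for
hulls of size TWO:

* `HullPort.hullPort_oneSteiner` — `o ∉ A` whose positive-weight neighbours are enumerated as `p 0, …, p (d−1)`, all relays
  except possibly the last one, which is then a non-relay `x` all of whose other positive-weight neighbours are relays; if
  `b ∈ A` is at least as `H`-light as every relay adjacent to `o` or to `x`, then `μ{1 ≤ N ≤ j} ≤ μ{|π(b)| ≤ j}`.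
  Proof ("sub-star principle", HULLPORT-COUPLING.md §2c): `HullPort.cil_of_edgeComparison` with the relay neighbours handled
  by the two-cluster exchange (`HullPort.portComparison_vertex`) and the last neighbour `x` by the self-referenced relay-port
  CIL for `x` in `G − o` (`Theorems.cil_of_portDomination`).
* `HullPort.hullPort_oneSteiner_exists` — the `∃ a ∈ A` form of `stub_cumulativeIsolation` on this class (witness = the most
  `H`-light port).

The class (observer with relay neighbours and at most one relay-neighboured Steiner neighbour) coincides with that of
`Theorems.cil_oneSteiner` (prover `prim-gen-swap`, CHAMPION witnesses); the statement here is the PORT-witness form the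
hull-port programme needs (its witnesses are not champions of `w`), and `cil_relayNeighbours` (`H`-best port) and
`cil_of_portDomination` (`G`-best port) are its two extreme cases.
[cite: VandenbergHaggstromKahn2005, Thm. 1.5 — the only probabilistic input]
-/

noncomputable section

namespace Summit.CriticalPhenomena.PercolationContinuityZ3.Theorems

open MeasureTheory Set Literature.Probability.LatticeModels Literature.Probability.Percolation
open scoped Classical BigOperators

variable {n : ℕ}

namespace HullPort

open CutObserver

/-- **The hull-port conjecture for hulls of size ≤ 2 (port witnesses for one-Steiner observers).**  Let `o ∉ A`; let its
positive-weight neighbours be `p 0, …, p (d−1)` (injective, `≠ o`), all relays except possibly the LAST index, and if the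
last neighbour `x = p l ∉ A` then every positive-weight pair at `x` other than `o–x` ends in a relay.  Let `b ∈ A` be at least
as `H`-light as every relay adjacent to `o` or to `x` (`H` = the pairs at `o` removed):
`μ{|π'(q)| ≤ j} ≤ μ{|π'(b)| ≤ j}`.  Then `μ{1 ≤ N ≤ j} ≤ μ{|π(b)| ≤ j}`. [this file] -/
theorem hullPort_oneSteiner (w : Sym2 (Fin n) → unitInterval) (A : Finset (Fin n)) (o : Fin n) (j : ℕ) {d : ℕ}
    (p : Fin d → Fin n) (hp : Function.Injective p) (hpo : ∀ l, p l ≠ o) (hoA : o ∉ A)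
    (hobs : ∀ v, v ≠ o → w s(o, v) ≠ 0 → ∃ l, v = p l) (hlast : ∀ l, p l ∉ A → ∀ m : Fin d, m ≤ l)
    (hSteiner : ∀ l, p l ∉ A → ∀ v, v ≠ o → w s(p l, v) ≠ 0 → v ∈ A)
    (b : Fin n) (hbA : b ∈ A)
    (hdom : ∀ q ∈ A, (∃ l, q = p l ∨ (p l ∉ A ∧ w s(p l, q) ≠ 0)) →
      (prodBernoulli w).real {ω : BondConfig (Fin n) |
          (A.filter fun x => (openGraph (ω ∩ {e | o ∉ e})).Reachable q x).card ≤ j} ≤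
        (prodBernoulli w).real {ω : BondConfig (Fin n) |
          (A.filter fun x => (openGraph (ω ∩ {e | o ∉ e})).Reachable b x).card ≤ j}) :
    (prodBernoulli w).real {ω : BondConfig (Fin n) |
        1 ≤ (A.filter fun x => ω ∈ openConn o x).card ∧ (A.filter fun x => ω ∈ openConn o x).card ≤ j} ≤
      (prodBernoulli w).real {ω : BondConfig (Fin n) | (A.filter fun x => ω ∈ openConn b x).card ≤ j} := by
  haveI : IsProbabilityMeasure (prodBernoulli w) := inferInstance
  have hbo : b ≠ o := fun h => hoA (h ▸ hbA)
  refine cil_of_edgeComparison w A o j p hp hpo hoA hobs hlast b hbo ?_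
  intro l hlb
  set R : BondConfig (Fin n) → Fin n → Fin n → Prop := fun ω u v =>
    (openGraph (ω ∩ {e | o ∉ e})).Reachable u v with hR
  by_cases hlA : p l ∈ A
  · -- a relay port: coin integration against `b`
    have hs := hdom (p l) hlA ⟨l, Or.inl rfl⟩
    have key := portComparison_vertex w A o j p hp b (Ne.symm hlb) hs (Finset.univ.filter fun m => l < m) {p l}
    have e1 : {ω : BondConfig (Fin n) | ¬ R ω (p l) b} ∩ {ω | ∀ m, l < m → R ω (p m) b → s(o, p m) ∉ ω} ∩
        {ω | 1 ≤ (A.filter fun x => R ω (p l) x).card ∧ (A.filter fun x => R ω (p l) x).card ≤ j} =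
        {ω : BondConfig (Fin n) | ∀ m ∈ (Finset.univ.filter fun m => l < m), R ω (p m) b → s(o, p m) ∉ ω} ∩
        {ω | ∀ v ∈ ({p l} : Finset (Fin n)), ¬ R ω v b} ∩
        {ω | (A.filter fun x => R ω (p l) x).card ≤ j} := by
      ext ω
      simp only [Finset.mem_filter, Finset.mem_univ, true_and, Finset.mem_singleton, forall_eq, mem_inter_iff,
        mem_setOf_eq]
      have h1 : 1 ≤ (A.filter fun x => R ω (p l) x).card :=
        Finset.card_pos.2 ⟨p l, Finset.mem_filter.2 ⟨hlA, SimpleGraph.Reachable.refl _⟩⟩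
      tauto
    have e2 : {ω : BondConfig (Fin n) | ¬ R ω (p l) b} ∩ {ω | ∀ m, l < m → R ω (p m) b → s(o, p m) ∉ ω} ∩
        {ω | (A.filter fun x => R ω b x).card ≤ j} =
        {ω : BondConfig (Fin n) | ∀ m ∈ (Finset.univ.filter fun m => l < m), R ω (p m) b → s(o, p m) ∉ ω} ∩
        {ω | ∀ v ∈ ({p l} : Finset (Fin n)), ¬ R ω v b} ∩
        {ω | (A.filter fun x => R ω b x).card ≤ j} := by
      ext ω
      simp only [Finset.mem_filter, Finset.mem_univ, true_and, Finset.mem_singleton, forall_eq, mem_inter_iff,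
        mem_setOf_eq]
      tauto
    simp only [hR] at e1 e2
    rw [e1, e2]
    exact key
  · -- the last neighbour is a Steiner vertex `x = p l`: no later pair, and the term is CIL for `x` in `G − o`
    have hvac : ∀ ω : BondConfig (Fin n), ∀ m : Fin d, l < m → R ω (p m) b → s(o, p m) ∉ ω :=
      fun ω m hm => absurd (hlast l hlA m) (not_le.2 hm)
    set u : Sym2 (Fin n) → unitInterval := fun e => if e ∈ {e : Sym2 (Fin n) | o ∉ e} then w e else 0 with hu
    have hux : ∀ v, v ≠ o → u s(p l, v) = w s(p l, v) := by
      intro v hv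
      have : o ∉ s(p l, v) := by
        rw [Sym2.mem_iff, not_or]; exact ⟨(hpo l).symm, hv.symm⟩
      simp only [hu, mem_setOf_eq, this, not_false_eq_true, if_true]
    have huo : ∀ v, u s(v, o) = 0 := by
      intro v; simp only [hu, mem_setOf_eq, Sym2.mem_iff, or_true, not_true_eq_false, if_false]
    -- rewrite both sides as `μ_u` of plain events
    set Lx := {ξ : BondConfig (Fin n) |
      1 ≤ (A.filter fun y => ξ ∈ openConn (p l) y).card ∧ (A.filter fun y => ξ ∈ openConn (p l) y).card ≤ j} with hLx
    set Tb := {ξ : BondConfig (Fin n) | (A.filter fun y => ξ ∈ openConn b y).card ≤ j} with hTb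
    set D := {ξ : BondConfig (Fin n) | ¬ (openGraph ξ).Reachable (p l) b} with hD
    have eL : {ω : BondConfig (Fin n) | ¬ R ω (p l) b} ∩ {ω | ∀ m, l < m → R ω (p m) b → s(o, p m) ∉ ω} ∩
        {ω | 1 ≤ (A.filter fun x => R ω (p l) x).card ∧ (A.filter fun x => R ω (p l) x).card ≤ j} =
        {ω : BondConfig (Fin n) | ω ∩ {e | o ∉ e} ∈ D ∩ Lx} := by
      ext ω
      simp only [hR, hD, hLx, mem_inter_iff, mem_setOf_eq, openConn]
      constructor
      · rintro ⟨⟨h1, _⟩, h3⟩; exact ⟨h1, h3⟩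
      · rintro ⟨h1, h3⟩; exact ⟨⟨h1, hvac ω⟩, h3⟩
    have eB : {ω : BondConfig (Fin n) | ¬ R ω (p l) b} ∩ {ω | ∀ m, l < m → R ω (p m) b → s(o, p m) ∉ ω} ∩
        {ω | (A.filter fun x => R ω b x).card ≤ j} =
        {ω : BondConfig (Fin n) | ω ∩ {e | o ∉ e} ∈ D ∩ Tb} := by
      ext ω
      simp only [hR, hD, hTb, mem_inter_iff, mem_setOf_eq, openConn]
      constructor
      · rintro ⟨⟨h1, _⟩, h3⟩; exact ⟨h1, h3⟩
      · rintro ⟨h1, h3⟩; exact ⟨⟨h1, hvac ω⟩, h3⟩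
    simp only [hR] at eL eB
    rw [eL, eB, measureReal_preimage_avoid, measureReal_preimage_avoid]
    change (prodBernoulli u).real (D ∩ Lx) ≤ (prodBernoulli u).real (D ∩ Tb)
    -- CIL for `x` in the graph `u` with witness `b`
    have hcil : (prodBernoulli u).real Lx ≤ (prodBernoulli u).real Tb := by
      set Qx := A.filter fun v => w s(p l, v) ≠ 0 with hQx
      by_cases hQ : Qx.card = 0
      · -- `x` has no relay neighbour: it is isolated in `u`
        have hiso : ∀ v, v ≠ p l → u s(p l, v) = 0 := by
          intro v hv
          by_cases hvo : v = o
          · rw [hvo]; exact huo (p l)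
          · rw [hux v hvo]
            by_contra hne
            have hvA := hSteiner l hlA v hvo hne
            have : v ∈ Qx := Finset.mem_filter.2 ⟨hvA, hne⟩
            rw [Finset.card_eq_zero] at hQ
            rw [hQ] at this
            exact absurd this (Finset.notMem_empty _)
        have h0 := measureReal_isolated_light_eq_zero u A (p l) hlA hiso univ j
        rw [univ_inter] at h0
        rw [hLx, h0]
        exact measureReal_nonneg
      · set q : Fin Qx.card → Fin n := fun i => (Qx.equivFin.symm i).1 with hq
        have hqinj : Function.Injective q := by
          intro i i' h
          exact Qx.equivFin.symm.injective (Subtype.ext h)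
        have hqA : ∀ i, q i ∈ A := fun i => (Finset.mem_filter.1 (Qx.equivFin.symm i).2).1
        have hqw : ∀ i, w s(p l, q i) ≠ 0 := fun i => (Finset.mem_filter.1 (Qx.equivFin.symm i).2).2
        have hobsx : ∀ v, u s(p l, v) ≠ 0 → ∃ i, v = q i := by
          intro v hv
          have hvo : v ≠ o := by rintro rfl; exact hv (huo (p l))
          rw [hux v hvo] at hv
          have hvA : v ∈ A := hSteiner l hlA v hvo hv
          have hvQ : v ∈ Qx := Finset.mem_filter.2 ⟨hvA, hv⟩
          refine ⟨Qx.equivFin ⟨v, hvQ⟩, ?_⟩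
          simp only [hq, Equiv.symm_apply_apply]
        have hdomx : ∀ i,
            (prodBernoulli u).real {ξ : BondConfig (Fin n) | (A.filter fun y => ξ ∈ openConn (q i) y).card ≤ j} ≤
              (prodBernoulli u).real {ξ : BondConfig (Fin n) | (A.filter fun y => ξ ∈ openConn b y).card ≤ j} := by
          intro i
          have h := hdom (q i) (hqA i) ⟨l, Or.inr ⟨hlA, hqw i⟩⟩
          have e2 : ∀ z : Fin n, {ω : BondConfig (Fin n) | (A.filter fun x => R ω z x).card ≤ j} =
              {ω : BondConfig (Fin n) | ω ∩ {e | o ∉ e} ∈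
                {ξ : BondConfig (Fin n) | (A.filter fun y => ξ ∈ openConn z y).card ≤ j}} := by
            intro z; ext ω; simp only [hR, mem_setOf_eq, openConn]
          simp only [hR] at e2
          rw [e2 (q i), e2 b, measureReal_preimage_avoid, measureReal_preimage_avoid] at h
          exact h
        exact cil_of_portDomination u A (p l) j q hqinj hqA hlA (Nat.pos_of_ne_zero hQ) hobsx b hdomx
    -- subtract the common part on `{x ~ b}`
    have hcommon : Lx ∩ Dᶜ = Tb ∩ Dᶜ := by
      ext ξ
      simp only [hLx, hTb, hD, mem_inter_iff, mem_setOf_eq, mem_compl_iff, not_not]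
      constructor
      · rintro ⟨⟨_, h2⟩, hr⟩
        refine ⟨?_, hr⟩
        have heq : (A.filter fun y => ξ ∈ openConn b y) = (A.filter fun y => ξ ∈ openConn (p l) y) :=
          Finset.filter_congr fun y _ => ⟨fun h => hr.trans h, fun h => hr.symm.trans h⟩
        rw [heq]; exact h2
      · rintro ⟨h2, hr⟩
        have heq : (A.filter fun y => ξ ∈ openConn (p l) y) = (A.filter fun y => ξ ∈ openConn b y) :=
          Finset.filter_congr fun y _ => ⟨fun h => hr.symm.trans h, fun h => hr.trans h⟩
        refine ⟨⟨?_, ?_⟩, hr⟩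
        · rw [heq]; exact Finset.card_pos.2 ⟨b, Finset.mem_filter.2 ⟨hbA, SimpleGraph.Reachable.refl _⟩⟩
        · rw [heq]; exact h2
    have sL := measureReal_inter_add_sdiff (μ := prodBernoulli u) (s := Lx) (MeasurableSet.of_discrete (s := D))
      (measure_ne_top _ _)
    have sT := measureReal_inter_add_sdiff (μ := prodBernoulli u) (s := Tb) (MeasurableSet.of_discrete (s := D))
      (measure_ne_top _ _)
    have hdL : Lx \ D = Lx ∩ Dᶜ := by ext ξ; simp only [mem_sdiff, mem_inter_iff, mem_compl_iff]
    have hdT : Tb \ D = Tb ∩ Dᶜ := by ext ξ; simp only [mem_sdiff, mem_inter_iff, mem_compl_iff]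
    rw [hdL, hcommon] at sL
    rw [hdT] at sT
    rw [inter_comm D Lx, inter_comm D Tb]
    linarith

/-- **CIL (`stub_cumulativeIsolation`) for observers whose hull has at most two vertices, hull-port witness.**  In the
setting of `hullPort_oneSteiner`, if `o` or its Steiner neighbour has at least one relay neighbour, then some relay `a ∈ A`
(the most `H`-light port) satisfies `μ{1 ≤ N ≤ j} ≤ μ{|π(a)| ≤ j}`. [this file] -/
theorem hullPort_oneSteiner_exists (w : Sym2 (Fin n) → unitInterval) (A : Finset (Fin n)) (o : Fin n) (j : ℕ) {d : ℕ}
    (p : Fin d → Fin n) (hp : Function.Injective p) (hpo : ∀ l, p l ≠ o) (hoA : o ∉ A)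
    (hobs : ∀ v, v ≠ o → w s(o, v) ≠ 0 → ∃ l, v = p l) (hlast : ∀ l, p l ∉ A → ∀ m : Fin d, m ≤ l)
    (hSteiner : ∀ l, p l ∉ A → ∀ v, v ≠ o → w s(p l, v) ≠ 0 → v ∈ A)
    (hport : ∃ q ∈ A, ∃ l, q = p l ∨ (p l ∉ A ∧ w s(p l, q) ≠ 0)) :
    ∃ a ∈ A,
      (prodBernoulli w).real {ω : BondConfig (Fin n) |
          1 ≤ (A.filter fun x => ω ∈ openConn o x).card ∧ (A.filter fun x => ω ∈ openConn o x).card ≤ j} ≤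
        (prodBernoulli w).real {ω : BondConfig (Fin n) | (A.filter fun x => ω ∈ openConn a x).card ≤ j} := by
  set Ports := A.filter fun q => ∃ l, q = p l ∨ (p l ∉ A ∧ w s(p l, q) ≠ 0) with hPorts
  set sH : Fin n → ℝ := fun q => (prodBernoulli w).real {ω : BondConfig (Fin n) |
    (A.filter fun x => (openGraph (ω ∩ {e | o ∉ e})).Reachable q x).card ≤ j} with hsH
  have hne : Ports.Nonempty := by
    obtain ⟨q, hqA, hq⟩ := hport
    exact ⟨q, Finset.mem_filter.2 ⟨hqA, hq⟩⟩
  obtain ⟨b, hb, hmax⟩ := Finset.exists_max_image Ports sH hne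
  have hbA : b ∈ A := (Finset.mem_filter.1 hb).1
  refine ⟨b, hbA, hullPort_oneSteiner w A o j p hp hpo hoA hobs hlast hSteiner b hbA ?_⟩
  intro q hqA hq
  exact hmax q (Finset.mem_filter.2 ⟨hqA, hq⟩)

end HullPort

end Summit.CriticalPhenomena.PercolationContinuityZ3.Theorems

end
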